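import Summits.Ventures.HodgeRepro2.T5SU11ResolventOfDecaySolution

/-!
# The resolvent near the origin is bounded by the `χ_λ`-weighted `L¹` norm of the source: `|G^I_λ g(t)| ≤ Φ ∫ χ_λ |g| sinh 2s ds`
for `0 < t ≤ 1`

Row 643's domination `|K_λ(t, s)| ≤ Φ χ_λ(s)` (`t ≤ 1`) in the kernel representation `G^I_λ g(t) = ∫ K_λ(t, s) g(s) sinh 2s ds`
(row 524) gives, for every source integrable against the basis — bounded or not —

* `abs_greenSolI_le_of_le_one` — **`|G^I_λ g(t)| ≤ Φ ∫_0^∞ χ_λ(s) |g(s)| sinh 2s ds`** for `0 < t ≤ 1`: a bound uniform on `(0, 1]`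
  with an explicit constant, sharpening row 493's boundedness at the origin and extending it to singular sources;
* `abs_greenSolI_sphDecay_le_of_le_one` — for the decaying solution `χ_{λ₂}` as source, `|G^I_λ χ_{λ₂}(t)| ≤ Φ ∫ χ_λ χ_{λ₂} sinh 2s ds`
  on `(0, 1]` (row 643's integrability).

Nothing is claimed about (N).

Blind lane: Mathlib + the HodgeRepro2 prefix only; no sorry; axioms ⊆ {propext, Classical.choice,
Quot.sound}.
-/

namespace Summit.Ventures.HodgeRepro2.T5SU11ResolventOriginBound

open Filter Topology MeasureTheory
open Set (Ioi Ioc Icc)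
open T5SU11Cartan T5SU11SphericalFunction T5SU11SphericalBounds T5SU11SphericalDecay T5SU11ReductionOfOrder
  T5SU11RadialGreenKernel T5SU11RadialGreenImproper T5SU11RadialGreenImproperOrigin T5SU11ResolventKernelComposition
  T5SU11ResolventTransformClass T5SU11SphericalDecayFluxIdentity T5SU11ResolventOfDecaySolution

section measure

variable [MeasurableSpace Circle] [BorelSpace Circle]

variable {lam : ℝ} (hlam : 1 < lam)

include hlam in
/-- **`|G^I_λ g(t)| ≤ Φ ∫_0^∞ χ_λ |g| sinh 2s ds`** for `0 < t ≤ 1`, where `φ_λ ≤ Φ` on `[0, 1]`, for every source `g` integrable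
against the basis. -/
theorem abs_greenSolI_le_of_le_one {g : ℝ → ℝ}
    (hB : ∀ T, IntegrableOn (fun s => sph lam (hyp s) * g s * Real.sinh (2 * s)) (Ioc 0 T))
    (hA : IntegrableOn (fun s => sphDecay lam s * g s * Real.sinh (2 * s)) (Ioi 0))
    {Φ : ℝ} (hΦ : ∀ u ∈ Icc (0 : ℝ) 1, sph lam (hyp u) ≤ Φ) {t : ℝ} (ht : 0 < t) (ht1 : t ≤ 1) :
    |greenSolI (fun t => sph lam (hyp t)) (sphDecay lam) g t|
      ≤ Φ * ∫ s in Ioi 0, sphDecay lam s * |g s| * Real.sinh (2 * s) := by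
  rw [greenSolI_eq_integral_kernel hB hA ht]
  have hint := integrableOn_kernel_mul hB hA ht
  change IntegrableOn (fun s => sphGreenKernel lam t s * g s * Real.sinh (2 * s)) (Ioi 0) at hint
  change |∫ s in Ioi 0, sphGreenKernel lam t s * g s * Real.sinh (2 * s)| ≤ _
  have hmaj : IntegrableOn (fun s => Φ * (sphDecay lam s * |g s| * Real.sinh (2 * s))) (Ioi 0) := by
    have h0 : IntegrableOn (fun s => Φ * |sphDecay lam s * g s * Real.sinh (2 * s)|) (Ioi 0) := hA.abs.const_mul Φ
    refine IntegrableOn.congr_fun h0 ?_ measurableSet_Ioi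
    intro s hs
    have hs' : (0 : ℝ) < s := hs
    simp only
    rw [abs_mul, abs_mul, abs_of_pos (sphDecay_pos hlam hs'), abs_of_pos (sinh_two_mul_pos hs')]
  calc |∫ s in Ioi 0, sphGreenKernel lam t s * g s * Real.sinh (2 * s)|
      ≤ ∫ s in Ioi 0, |sphGreenKernel lam t s * g s * Real.sinh (2 * s)| := abs_integral_le_integral_abs
    _ ≤ ∫ s in Ioi 0, Φ * (sphDecay lam s * |g s| * Real.sinh (2 * s)) := by
        refine setIntegral_mono_on hint.abs hmaj measurableSet_Ioi fun s hs => ?_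
        have hs' : (0 : ℝ) < s := hs
        have hK := abs_kernel_le_mul_sphDecay_of_le_one hlam hΦ ht ht1 hs'
        have hsh : 0 ≤ Real.sinh (2 * s) := (sinh_two_mul_pos hs').le
        rw [abs_mul, abs_mul, abs_of_nonneg hsh]
        have h1 : 0 ≤ |g s| * Real.sinh (2 * s) := mul_nonneg (abs_nonneg _) hsh
        calc |sphGreenKernel lam t s| * |g s| * Real.sinh (2 * s)
            ≤ Φ * sphDecay lam s * |g s| * Real.sinh (2 * s) := by
              have := mul_le_mul_of_nonneg_right hK h1
              nlinarith [this]
          _ = Φ * (sphDecay lam s * |g s| * Real.sinh (2 * s)) := by ring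
    _ = Φ * ∫ s in Ioi 0, sphDecay lam s * |g s| * Real.sinh (2 * s) := by
        rw [MeasureTheory.integral_const_mul]

include hlam in
/-- For the decaying solution `χ_{λ₂}` as source: `|G^I_λ χ_{λ₂}(t)| ≤ Φ ∫_0^∞ χ_λ χ_{λ₂} sinh 2s ds` on `(0, 1]`. -/
theorem abs_greenSolI_sphDecay_le_of_le_one {lam₂ : ℝ} (hlam₂ : 1 < lam₂)
    {Φ : ℝ} (hΦ : ∀ u ∈ Icc (0 : ℝ) 1, sph lam (hyp u) ≤ Φ) {t : ℝ} (ht : 0 < t) (ht1 : t ≤ 1) :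
    |greenSolI (fun t => sph lam (hyp t)) (sphDecay lam) (sphDecay lam₂) t|
      ≤ Φ * ∫ s in Ioi 0, sphDecay lam s * sphDecay lam₂ s * Real.sinh (2 * s) := by
  -- the integrabilities of `χ_{λ₂}` against the basis of `λ` (row 643)
  have hA : IntegrableOn (fun s => sphDecay lam s * sphDecay lam₂ s * Real.sinh (2 * s)) (Ioi 0) :=
    integrableOn_sphDecay_mul_sphDecay_mul_sinh hlam₂ hlam
  have hB : ∀ T, IntegrableOn (fun s => sph lam (hyp s) * sphDecay lam₂ s * Real.sinh (2 * s)) (Ioc 0 T) := by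
    intro T
    have h := integrableOn_sphDecay_mul_sinh_Ioc hlam₂ T
    have hcont : ContinuousOn (fun s => sph lam (hyp s) * sphDecay lam₂ s * Real.sinh (2 * s)) (Ioi 0) := by
      have hχ : ContinuousOn (sphDecay lam₂) (Ioi 0) :=
        fun _ hr => (hasDerivAt_sphDecay hlam₂ hr).continuousAt.continuousWithinAt
      exact ((T5SU11SphericalContinuous.continuous_sph_hyp lam).continuousOn.mul hχ).mul
        (Real.continuous_sinh.comp (continuous_const.mul continuous_id)).continuousOn
    obtain ⟨Φ', hΦ'⟩ := (isCompact_Icc (a := (0 : ℝ)) (b := T)).exists_bound_of_continuousOn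
      (T5SU11SphericalContinuous.continuous_sph_hyp lam).continuousOn
    refine (h.const_mul Φ').mono' ((hcont.mono Set.Ioc_subset_Ioi_self).aestronglyMeasurable measurableSet_Ioc) ?_
    refine ae_restrict_of_forall_mem measurableSet_Ioc fun s hs => ?_
    have hs' : (0 : ℝ) < s := hs.1
    rw [Real.norm_eq_abs, abs_mul, abs_mul, abs_of_pos (sphDecay_pos hlam₂ hs'), abs_of_pos (sinh_two_mul_pos hs')]
    have h1 : |sph lam (hyp s)| ≤ Φ' := by simpa only [Real.norm_eq_abs] using hΦ' s ⟨hs'.le, hs.2⟩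
    have hχ : 0 < sphDecay lam₂ s := sphDecay_pos hlam₂ hs'
    have hsh : 0 < Real.sinh (2 * s) := sinh_two_mul_pos hs'
    calc |sph lam (hyp s)| * sphDecay lam₂ s * Real.sinh (2 * s) ≤ Φ' * sphDecay lam₂ s * Real.sinh (2 * s) := by
          have := mul_le_mul_of_nonneg_right (mul_le_mul_of_nonneg_right h1 hχ.le) hsh.le
          linarith
      _ = Φ' * (sphDecay lam₂ s * Real.sinh (2 * s)) := by ring
  have h := abs_greenSolI_le_of_le_one hlam hB hA hΦ ht ht1
  refine le_trans h (le_of_eq ?_)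
  congr 1
  apply setIntegral_congr_fun measurableSet_Ioi
  intro s hs
  have hs' : (0 : ℝ) < s := hs
  simp only
  rw [abs_of_pos (sphDecay_pos hlam₂ hs')]

end measure

end Summit.Ventures.HodgeRepro2.T5SU11ResolventOriginBound
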